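import Literature.NumberTheory.Automorphic.ShimuraCurveRibetTakahashiOptimalProofs
import Literature.NumberTheory.EllipticCurves.ManinConstantDeuringTwistProofs
import Literature.NumberTheory.EllipticCurves.NeronIsogenyScalingHoldsProofs
import Literature.NumberTheory.EllipticCurves.PastenValuationProductThm75SieveProofs
import HarnessLib

/-!
# The Manin constant of an ARBITRARY modular parametrisation is an integer (Stevens-strength integrality, proofs only)

Topic `NumberTheory/EllipticCurves` (theorems only; no definition, no named fact).  Several tree files
(`ShimuraCurveRibetTakahashiOptimalProofs` — the hypothesis `hInt` of `exists_optimal_modularParametrizationData_of`,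
`exists_int_cast_eq_of_latticeEq`; `PastenSpectralDegreeIsogenyBoundProofs` —
`PastenShimura2024_minimalDegree_le_163_mul_of_mazurKenku`; `PastenValuationProductThm75SieveProofs` —
`pasten_thm_7_5_of_exists_isNewformOf_mazurKenku_edixhoven`) carry as a HYPOTHESIS the Stevens-strength integrality

  `hInt`: for every globally minimal elliptic `W'/ℚ`, every `X₀(N)`-datum `D'` of `W'` and every `q ∈ ℚ` with
  `q·Λ_{D'.f} ⊆ Λ_{W'}`, `q ∈ ℤ`

— the Manin constant of an ARBITRARY parametrisation `X₀(N) → E'` (not only of the optimal one) is an integer (Stevens 1989, §1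
Thm. 1.3; Agashe–Ribet–Stein 2006, Thm. 2.2 and §2; Česnavičius–Neururer–Saha 2024, §1: "any `φ` factors through an optimal one").
It is a THEOREM of the tree's ingredients: Edixhoven's Prop. 2 for the OPTIMAL curve (`edixhoven_int_of_neronLattice_eq_smul_periodLattice_holds`:
the global minimal model `W₀` of `E_f = ℂ/Λ_f`, `D'.exists_isGloballyMinimal_latticeEq_rat`, has Néron lattice `q₀·Λ_f` with `q₀ ∈ ℤ`) and
the integrality of the Néron scaling of the rational isogeny `W₀ → W'`, `z ↦ (q/q₀)·z`
(`integral_neronScaling_of_isGloballyMinimal_holds`): `q/q₀ ∈ ℤ`, so `q ∈ q₀ℤ ⊆ ℤ`.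

* `ModularParametrizationData.int_of_smul_periodLattice_le` — `hInt` as a theorem;
* `PastenShimura2024_minimalDegree_le_163_mul_of_mazurKenku'` — Pasten 2024 Cor. of Thm. 7.2 ⟸ Mazur–Kenku ALONE;
* `pasten_thm_7_5_of_exists_isNewformOf_mazurKenku'` — Pasten 2024 Thm. 7.5 ⟸ {modularity, Mazur–Kenku} (Edixhoven input discharged).

## References
* G. Stevens, *Stickelberger elements and modular parametrizations of elliptic curves*, Invent. Math. 98 (1989), §1 (Thm. 1.3). [Stevens1989]
* A. Agashe, K. Ribet, W. Stein, *The Manin constant*, PAMQ 2 (2006), §2, Thm. 2.2. [AgasheRibetStein2006]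
* B. Edixhoven, *On the Manin constants of modular elliptic curves* (1991), Prop. 2. [EdixhovenManin1991]
* H. Pasten, *Shimura curves and the abc conjecture*, J. Number Theory (2024), §3 p. 13, Thm. 7.5. [PastenShimura2024]
-/

noncomputable section

open scoped MatrixGroups ModularForm
open CongruenceSubgroup WeierstrassCurve
open Literature.NumberTheory.EllipticCurves Literature.NumberTheory.EllipticCurves.ModularForms

namespace Literature.NumberTheory.EllipticCurves.ModularForms

/-- **The Manin constant of an arbitrary modular parametrisation is an integer** (Stevens-strength integrality, the tree's
hypothesis `hInt`): for a globally minimal elliptic `W'/ℚ`, an `X₀(N)`-datum `D'` of `W'` and `q ∈ ℚ` with `q·Λ_{D'.f} ⊆ Λ_{W'}`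
— i.e. `τ ↦ u_{W'}(q·ℰ_f(τ))` is a modular parametrisation of `W'` pulling the Néron differential back to `q·2πi f dτ` — we have
`q ∈ ℤ`.  Proof: Edixhoven's Prop. 2 for the global minimal model `W₀` of `E_f` (`Λ_{W₀} = q₀Λ_f`, `q₀ ∈ ℤ`) and the integrality of
the Néron scaling `q/q₀` of the rational isogeny `W₀ → W'`. [cite: Stevens1989, §1 Thm. 1.3] [cite: AgasheRibetStein2006, Thm. 2.2]
[cite: EdixhovenManin1991, Prop. 2] -/
theorem ModularParametrizationData.int_of_smul_periodLattice_le {N : ℕ} [NeZero N] {W' : WeierstrassCurve ℚ}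
    [W'.IsElliptic] [W'.IsGloballyMinimal] (D' : ModularParametrizationData W' N) (q : ℚ)
    (hq : ∀ z ∈ periodLattice D'.f, (q : ℂ) * z ∈ D'.L.lattice) : ∃ k : ℤ, (k : ℚ) = q := by
  -- the global minimal model `W₀` of `E_f`, Néron lattice `q₀·Λ_f`, `q₀ ∈ ℤ` (Edixhoven)
  obtain ⟨W₀, hW₀, hW₀', L₀, q₀, hf₀, hL₀, hq₀0, hq₀, hq₀'⟩ := D'.exists_isGloballyMinimal_latticeEq_rat
  haveI := hW₀
  haveI := hW₀'
  obtain ⟨k₀, hk₀⟩ := edixhoven_int_of_neronLattice_eq_smul_periodLattice_holds hf₀ hL₀ q₀ hq₀ hq₀'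
  -- the Néron scaling `q/q₀` of `W₀ → W'` is an integer
  have hq₀C : (q₀ : ℂ) ≠ 0 := by exact_mod_cast hq₀0
  obtain ⟨k, hk⟩ := integral_neronScaling_of_isGloballyMinimal_holds W₀ W' L₀ D'.L hL₀ D'.isNeronLattice (q / q₀)
    (fun z hz ↦ by
      obtain ⟨w, hw, rfl⟩ := hq₀' z hz
      have e : (((q / q₀ : ℚ)) : ℂ) * ((q₀ : ℂ) * w) = (q : ℂ) * w := by
        push_cast
        field_simp
      rw [e]
      exact hq w hw)
  refine ⟨k * k₀, ?_⟩
  rw [Int.cast_mul, hk, hk₀]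
  field_simp

/-- The same in the binder shape of the tree's hypothesis `hInt` (for `exact`-ing into its consumers). [cite: Stevens1989, §1 Thm. 1.3] -/
theorem int_of_smul_periodLattice_le_all :
    ∀ {N : ℕ} [NeZero N] {W' : WeierstrassCurve ℚ} [W'.IsElliptic] [W'.IsGloballyMinimal]
      (D' : ModularParametrizationData W' N) (q : ℚ),
      (∀ z ∈ periodLattice D'.f, (q : ℂ) * z ∈ D'.L.lattice) → ∃ k : ℤ, (k : ℚ) = q :=
  fun D' q hq ↦ D'.int_of_smul_periodLattice_le q hq

/-- **Pasten 2024, the minimal-degree bound `deg ≤ 163·(optimal degree)` ⟸ Mazur–Kenku alone** (the tree's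
`PastenShimura2024_minimalDegree_le_163_mul_of_mazurKenku` with its Edixhoven/Stevens input `hInt` discharged).
[cite: PastenShimura2024, §3 p. 13] [cite: Mazur1978, Thm. 1] [cite: Kenku1982] -/
theorem PastenShimura2024_minimalDegree_le_163_mul_of_mazurKenku' (hMK : mazurKenku_exists_cyclic_isogeny) :
    PastenShimura2024_minimalDegree_le_163_mul :=
  PastenShimura2024_minimalDegree_le_163_mul_of_mazurKenku hMK int_of_smul_periodLattice_le_all

/-- **Pasten 2024, Thm. 7.5 ⟸ {modularity, Mazur–Kenku}** (the tree's `pasten_thm_7_5_of_exists_isNewformOf_mazurKenku_edixhoven` with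
its Edixhoven/Stevens input `hInt` discharged). [cite: PastenShimura2024, Theorem 7.5] [cite: Mazur1978, Thm. 1] [cite: Kenku1982]
[cite: BCDTJAMS2001, Thm. A] -/
theorem pasten_thm_7_5_of_exists_isNewformOf_mazurKenku' (h₁ : exists_isNewformOf) (hMK : mazurKenku_exists_cyclic_isogeny) :
    pasten_thm_7_5 :=
  pasten_thm_7_5_of_exists_isNewformOf_mazurKenku_edixhoven h₁ hMK int_of_smul_periodLattice_le_all

end Literature.NumberTheory.EllipticCurves.ModularForms

end
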